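import Summits.Ventures.HodgeRepro2.T5FinitePlaceNegOneNorm

/-!
# `(U)` at ANY finite non-split place reduces to ONE statement: `−1` is a sum of two norms
(cell pub-hodge-repro2, seat p3)

Tier-5 N2 support, rows N2.2.2 / N2.8.1 of route/T5-N2-route-3.md — the residual binder of the local
classification in its sharpest form. Files 143 / 144 / 147 proved `(U′)` «every element of `F_v` is a sum of two
norms from `E_w`» at the non-dyadic, the inert, and the «`−1` is a norm» places. Here, at EVERY finite non-split
place, `(U′)` is shown EQUIVALENT to the single statement «`−1` is a sum of two norms» (the isotropy of the
hermitian form `⟨1, 1, 1⟩` over `E_w`):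

* `isSumTwoNorms_of_neg_one`: if `−1 = N(x₁) + N(x₂)` then every `y` is a sum of two norms — for `−1 ∈ N` by
  file 147, otherwise `−y ∈ N` for every non-norm `y` (the product of two non-norms is a norm) and
  `y = N(z)·(−1) = N(z x₁) + N(z x₂)`;
* `isSumTwoNorms_iff`: `(∀ y, IsSumTwoNorms y) ↔ IsSumTwoNorms (−1)`;
* **`binaryUniversal_of_neg_one_sum`**: `(U)` on `E_w` whenever `−1 = star x · x + star y · y` for some
  `x, y ∈ E_w`, at any finite non-split place, with Shimura's Lemma 1.6 and HKS96's two classes as corollaries.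

So the ONE local input still displayed by this lane at a ramified dyadic place is «`⟨1, 1, 1⟩` is isotropic over
`E_w`» (Jacobowitz 1962: hermitian forms of rank `≥ 3` over a local field are isotropic). Mathlib + this seat's
files 141–144, 147 and seat p4's chain through them only; no display; no device. §8(d): uses an L-value-free
non-vanishing device: NO.
-/

namespace Summit.Ventures.HodgeRepro2.T5FinitePlaceNegOneSum

open IsDedekindDomain IsDedekindDomain.HeightOneSpectrum NumberField Module
open Summit.Ventures.HodgeRepro2.T5FinitePlaceTensorEquiv Summit.Ventures.HodgeRepro2.T5FinitePlaceStar
  Summit.Ventures.HodgeRepro2.T5FinitePlaceIsometryCriterion Summit.Ventures.HodgeRepro2.T5HilbertSymbolNorm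
  Summit.Ventures.HodgeRepro2.T5HermitianDetClass Summit.Ventures.HodgeRepro2.T5HermitianClassify
  Summit.Ventures.HodgeRepro2.T5HermitianTwoClasses Summit.Ventures.HodgeRepro2.T5AdicCompletionNormGroup
  Summit.Ventures.HodgeRepro2.T5LocalNormIndex Summit.Ventures.HodgeRepro2.T5FinitePlaceNormIndex
  Summit.Ventures.HodgeRepro2.T5FinitePlaceSumTwoNorms Summit.Ventures.HodgeRepro2.T5FinitePlaceBinaryUniversal
  Summit.Ventures.HodgeRepro2.T5FinitePlaceBinaryUniversalInert Summit.Ventures.HodgeRepro2.T5FinitePlaceNegOneNorm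

section Local

variable {K : Type*} [Field K] [NumberField K] (v : HeightOneSpectrum (NumberField.RingOfIntegers K))
  {L : Type*} [Field L] [NumberField L] [Algebra K L]
  (w : HeightOneSpectrum (NumberField.RingOfIntegers L)) [w.asIdeal.LiesOver v.asIdeal]
  (σ : Gal(adicCompletion L w/adicCompletion K v))
  (h2 : Module.finrank (adicCompletion K v) (adicCompletion L w) = 2) (hσ : σ ≠ 1)

include h2 hσ in
/-- **`(U′)` from «`−1` is a sum of two norms»**, at any finite non-split place: if `−1 ∈ N` use file 147; otherwise
`−y ∈ N` for a non-norm `y` and `y = N(z)·(−1)` is a sum of two norms. -/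
theorem isSumTwoNorms_of_neg_one (hneg : IsSumTwoNorms v w σ (-1)) (y : (adicCompletion K v)ˣ) :
    IsSumTwoNorms v w σ y := by
  by_cases hN : (-1 : (adicCompletion K v)ˣ) ∈ normGroup v w σ
  · exact isSumTwoNorms_of_neg_one_mem v w σ hN y
  by_cases hy : y ∈ normGroup v w σ
  · exact isSumTwoNorms_of_mem v w σ hy
  have hidx := index_normGroup_eq_two v w σ h2 hσ
  have hmem : y * (-1) ∈ normGroup v w σ := (Subgroup.mul_mem_iff_of_index_two hidx).2 (iff_of_false hy hN)
  obtain ⟨z, hz⟩ := hmem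
  obtain ⟨x₁, x₂, hx⟩ := hneg
  refine ⟨z * x₁, z * x₂, ?_⟩
  have hy' : (y : adicCompletion K v) = ((y * (-1) : (adicCompletion K v)ˣ) : adicCompletion K v) * (-1) := by
    rw [Units.val_mul, Units.val_neg, Units.val_one]
    ring
  rw [hy', map_mul (algebraMap (adicCompletion K v) (adicCompletion L w)), ← hz, ← hx, map_mul σ z x₁,
    map_mul σ z x₂]
  ring

include h2 hσ in
/-- `(U′)` at a finite non-split place is EQUIVALENT to «`−1` is a sum of two norms». -/
theorem isSumTwoNorms_iff :
    (∀ y : (adicCompletion K v)ˣ, IsSumTwoNorms v w σ y) ↔ IsSumTwoNorms v w σ (-1) :=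
  ⟨fun h => by simpa using h (-1), fun h y => isSumTwoNorms_of_neg_one v w σ h2 hσ h y⟩

end Local

section Universal

variable {F E : Type*} [Field F] [NumberField F] [Field E] [NumberField E] [Algebra F E]
  [Algebra.IsQuadraticExtension F E]
variable (v : HeightOneSpectrum (𝓞 F)) (w : HeightOneSpectrum (𝓞 E)) [w.asIdeal.LiesOver v.asIdeal]
variable {s : E} {θ : F}
variable (hs : s ^ 2 = algebraMap F E θ) (hspan : Submodule.span F {(1 : E), s} = ⊤)
  (hsq : ¬ IsSquare (algebraMap F (v.adicCompletion F) θ)) (c : E ≃ₐ[F] E) (hc : c s = -s)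

/-- **`(U)` on `E_w` at any finite non-split place, modulo the isotropy of `⟨1, 1, 1⟩`:** if
`−1 = star x · x + star y · y` for some `x, y ∈ E_w` then every binary diagonal hermitian form represents every
element of `F_v^×`. -/
theorem binaryUniversal_of_neg_one_sum
    (hneg : letI := localStarRing v w hs hspan hsq c hc;
      ∃ x y : w.adicCompletion E, star x * x + star y * y = -1) :
    letI := localStarRing v w hs hspan hsq c hc
    BinaryUniversal (w.adicCompletion E) := by
  letI := localStarRing v w hs hspan hsq c hc
  have hneg' : IsSumTwoNorms v w (localConj v w hs hspan hsq c) (-1) := by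
    obtain ⟨x, y, hxy⟩ := hneg
    refine ⟨x, y, ?_⟩
    rw [map_neg, map_one, ← hxy, localConj_eq_star v w hs hspan hsq c hc, localConj_eq_star v w hs hspan hsq c hc,
      mul_comm x, mul_comm y]
  exact binaryUniversal_of_forall_isSumTwoNorms v w hs hspan hsq c hc fun y =>
    isSumTwoNorms_of_neg_one v w (localConj v w hs hspan hsq c) (finrank_eq_two' v w hs hspan hsq)
      (localConj_ne_one v w hs hspan hsq c hc) hneg' y

/-- Shimura's Lemma 1.6 on `E_w` modulo the isotropy of `⟨1, 1, 1⟩`, at any finite non-split place. -/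
theorem isCongruent_iff_exists_det_eq_local_of_neg_one_sum
    (hneg : letI := localStarRing v w hs hspan hsq c hc;
      ∃ x y : w.adicCompletion E, star x * x + star y * y = -1)
    {ι : Type*} [Fintype ι] [DecidableEq ι] {H H' : Matrix ι ι (w.adicCompletion E)}
    (hH : letI := localStarRing v w hs hspan hsq c hc; H.IsHermitian)
    (hH' : letI := localStarRing v w hs hspan hsq c hc; H'.IsHermitian) (hdet : IsUnit H.det) :
    letI := localStarRing v w hs hspan hsq c hc
    IsCongruent H H' ↔ ∃ u : w.adicCompletion E, u ≠ 0 ∧ H'.det = star u * u * H.det := by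
  letI := localStarRing v w hs hspan hsq c hc
  exact isCongruent_iff_exists_det_eq (exists_add_star_ne_zero_local v w hs hspan hsq c hc)
    (binaryUniversal_of_neg_one_sum v w hs hspan hsq c hc hneg) hH hH' hdet

/-- HKS96's «precisely two isomorphism classes in each dimension» on `E_w` modulo the isotropy of `⟨1, 1, 1⟩`,
at any finite non-split place. -/
theorem exists_two_classes_local_of_neg_one_sum
    (hneg : letI := localStarRing v w hs hspan hsq c hc;
      ∃ x y : w.adicCompletion E, star x * x + star y * y = -1) (m : ℕ) :
    letI := localStarRing v w hs hspan hsq c hc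
    ∃ H₁ H₂ : Matrix (Fin (m + 1)) (Fin (m + 1)) (w.adicCompletion E),
      H₁.IsHermitian ∧ H₂.IsHermitian ∧ IsUnit H₁.det ∧ IsUnit H₂.det ∧ ¬ IsCongruent H₁ H₂ ∧
        ∀ H : Matrix (Fin (m + 1)) (Fin (m + 1)) (w.adicCompletion E), H.IsHermitian → IsUnit H.det →
          IsCongruent H H₁ ∨ IsCongruent H H₂ := by
  letI := localStarRing v w hs hspan hsq c hc
  exact exists_two_classes_local v w hs hspan hsq c hc (binaryUniversal_of_neg_one_sum v w hs hspan hsq c hc hneg) m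

end Universal

end Summit.Ventures.HodgeRepro2.T5FinitePlaceNegOneSum
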